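import Literature.AlgebraicGeometry.Resolution.RidgeLocal
import Literature.AlgebraicGeometry.Resolution.HilbertSamuelStrata
import Literature.AlgebraicGeometry.Resolution.PermissibleCentres
import Literature.AlgebraicGeometry.Resolution.Blowups
import Mathlib.AlgebraicGeometry.ResidueField
import Mathlib.RingTheory.AlgebraicIndependent.Basic
import HarnessLib

/-!
# [OURS · L1 W4.2] Ridge statements for the informal crux `RidgeConfinement` (stmt-ResolutionOfSingularities-17845)
# — campaign s42 of cell res-hironaka (LADDER-RESOLUTION rung L, D-0089); host route HilbertSamuelElimination (DRAFT),
# `--kind definition --supports stmt-ResolutionOfSingularities-18506`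

HONEST FRAMING. Everything below is OURS (campaign statements of slot W4.2, typed by res-L1-type-o1 in the statement-only
lane on the brief plan/SIZED-ASK-L.md v0.2 §S S-s42) over the TREE's published-mathematics library
(`Literature/AlgebraicGeometry/Resolution/RidgeLocal.lean`: Giraud's ridge `F_x(X)`, `Scheme.ridgeDim`; `HilbertSamuelStrata`:
CJS's `H_X^N(x)` = `Scheme.hsFun`; `PermissibleCentres`: CJS Def. 3.1 `IdealSheafData.IsPermissible`; `Blowups`:
`IsBlowup`). NOTHING here is a statement of H. Hironaka's manuscript [Hironaka2017] (the W4.2 slot REPLACES the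
manuscript's invariant by the Hilbert–Samuel / ridge architecture of Hironaka 1964 – Giraud 1975 – CJS 2020); nothing is
asserted: every claim-shaped decl is a `def … : Prop`. The informal crux (route file docstring, stmt-17845) reads: «for
every excellent scheme X (in the route: reduced separated of finite type over a field of characteristic p), every
permissible centre D ⊆ X (regular, X normally flat along D), every x ∈ D and every point x′ of Bl_D(X) over x that is NEAR
to x (H_{X′}(x′) = H_X(x)), x′ lies in the projective space P(F_x(X)/T_x(D)) ⊆ π⁻¹(x) of Giraud's RIDGE … moreover
dim F_{x′}(X′) ≤ dim F_x(X) − trdeg(k(x′)/k(x)) at near points … and F_red = Dir over perfect residue fields». This file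
types the two halves the tree has language for TODAY — the MONOTONICITY inequality and the PERFECT-RESIDUE-FIELD
equality `dim F_x(X) = e_x(X)` — and records the CONFINEMENT half (Giraud 1975 Cor. 2.4: near points lie in
`ℙ(F_x(X)/T_x(D))`) as NOT TYPED: `RidgeLocal.lean`'s module docstring states «Not here: … `ℙ(F_x(X)/T_x(D))` and Giraud's
Cor. 2.4 (the crux `RidgeConfinement`)» — the projectivised-quotient object is a definition request of its own
(res-L1-s42-plan-1 / CHAIN w42 `Ridge` request; shared with slot W5.4 per S-s54). AI review is weaker than expert review.
No `sorry`, no theorem (statement-only).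

## Decls (namespace `…Theorems.CampaignW42`)

* `IsNearPoint π N x'` — «`x′` is NEAR to `x = π(x′)`» (CJS: `H^N_{X′}(x′) = H^N_X(π x′)`; for permissible blow-ups
  `H^N_{X′}(x′) ≤ H^N_X(π x′)` is CJS Thm. 3.10 (1) = the host crux's monotonicity clause, FACT-LIST / tree
  `IsBlowup.hsFun_le_of_isPermissible`).
* `residueAlgebra π x'` — the `κ(π x′)`-algebra structure on `κ(x′)` given by `π` (Mathlib `Scheme.Hom.residueFieldMap`),
  a reducible `abbrev` (no instance, typer lint), consumed explicitly by `Algebra.trdeg`.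
* `RidgeDimDropAt π x'` — the MONOTONICITY INEQUALITY at one point: `dim F_{x′}(X′) + trdeg(κ(x′)/κ(x)) ≤ dim F_x(X)`
  (in `Cardinal`, where Mathlib's `Algebra.trdeg` lives; `Scheme.ridgeDim` cast).
* `RidgeDimMonotone p` — [OURS · L1 W4.2] replaces the role of the SECOND HALF of `RidgeConfinement` (stmt-17845): for
  every field `k` of characteristic `p`, reduced separated `X` of finite type over `k`, permissible centre `D`
  (`IdealSheafData.IsPermissible`), blow-up `π : X′ → X` along `D`, `N ≥ dim X`, and every point `x′` over `V(D)` near to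
  `π x′`: `RidgeDimDropAt π x′`. The ridge analogue of CJS Thm. 3.10 (4) for `e_x`; «only sketched in print» (CPSc 2017,
  Schober 2021) per the item's own caveat — a CAMPAIGN STATEMENT to prove or refute, not a fact.
* `RidgeDimEqDirDimOfPerfect p` — [OURS · L1 W4.2] the SANITY RUNG of S-s42 («Rid_red = Dir over perfect residue fields»,
  route-file remark; Giraud 1975 §1.5): at every point with PERFECT residue field, `dim F_x(X) = e_x(X)`
  (`Scheme.ridgeDim = Scheme.dirDim`; `≤` is the tree's `Scheme.dirDim_le_ridgeDim`).

## DESIGN POINTS (for res-L1-s42-plan-1, CHAIN w42 plan-1, and the OURS lanes)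

* (CONF) the confinement half needs `ℙ(F_x(X)/T_x(D)) ⊆ π⁻¹(x)`: the exceptional fibre of `Bl_D X` over `x` as
  `Proj` of the normal cone fibre and the image of the ridge in it. Not typed; when the `Ridge`/projectivisation request
  lands, `RidgeConfinement`'s signature = `RidgeConfines p ∧ RidgeDimMonotone p` (∧ the perfect-field clause if w42 wants it).
* (NEAR) «near» is typed with the tree's `H^N` at a level `N ≥ dim X` (the host items' idiom, `topologicalKrullDim X ≤ N`);
  CJS's `H_X` without `N` differs by the shift `φ`, immaterial for equality at `x′` over `x` only when `ψ_{X′}(x′) = ψ_X(x)` —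
  recorded, not resolved: the statement quantifies `N` as the host crux does.
* (TRDEG) `trdeg(κ(x′)/κ(x))` as Mathlib's `Algebra.trdeg` (a `Cardinal`; finite here since `π` is of finite type, not
  used).
* (SCOPE) the informal item says «every excellent scheme»; typed in the ROUTE's scope (reduced separated finite type over a
  field of characteristic `p`, per prime `p`), exactly as `SigmaMaxModifications` is; `[IsLocallyNoetherian]` instances
  are carried as explicit instance hypotheses because `Scheme.ridgeDim` is stated under them in the tree.
* (VAC) VACUITY: `RidgeDimMonotone p` is not vacuous — permissible centres and near points exist (e.g. the origin of the
  Whitney umbrella, or Hironaka's quadric of `DirectrixSmallCharacteristic`, where a near point EXISTS with `Dir = 0`: the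
  statement must hold THERE first, brief S-s42); `RidgeDimEqDirDimOfPerfect p` is not vacuous (closed points of varieties
  over perfect fields) and is NOT implied by `dirDim ≤ ridgeDim` alone.

## References

* J. Giraud, *Contact maximal en caractéristique positive*, Ann. Sci. ÉNS (4) 8 (1975), §1.5, Cor. 2.4, §3.3.1. [Giraud1975]
* V. Cossart, U. Jannsen, S. Saito, *Desingularization: Invariants and Strategy*, LNM 2270 (2020), Def. 2.28, Def. 3.1,
  Thm. 3.10, Thm. 3.14, Rem. 18.29. [CossartJannsenSaito2020]
* V. Cossart, O. Piltant, B. Schober, C. R. Math. 355 (2017) 455–459 (ridge as secondary invariant) — context.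
* plan/SIZED-ASK-L.md v0.2 §S S-s42; route file Theses/HilbertSamuelElimination.lean (items 17845/17846, barrier notes).
-/

noncomputable section

set_option linter.dupNamespace false -- mandated namespace of this single-conjunct summit

open CategoryTheory AlgebraicGeometry TopologicalSpace

namespace Summit.ResolutionOfSingularities.ResolutionOfSingularities.Theorems

namespace CampaignW42

open Literature.AlgebraicGeometry.Resolution

universe u

variable {X X' : Scheme.{u}}

/-- [OURS · L1 W4.2] «`x′` is NEAR to `x = π(x′)`» at level `N`: the Hilbert–Samuel functions agree,
`H^N_{X′}(x′) = H^N_X(π x′)` (CJS Def. 2.28 / the near-point notion of Thm. 3.14, with the tree's `Scheme.hsFun`). For a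
permissible blow-up `≤` always holds (CJS Thm. 3.10 (1)). OURS rendering of the notion of CJS 2020 (LNM 2270) Thm. 3.14;
NOT a statement of the manuscript. [folklore] -/
def IsNearPoint (π : X' ⟶ X) (N : ℕ) (x' : X') : Prop :=
  Scheme.hsFun X' N x' = Scheme.hsFun X N (π.base x')

/-- [OURS · L1 W4.2] the `κ(π x′)`-algebra structure on `κ(x′)` induced by `π` (Mathlib `Scheme.Hom.residueFieldMap`), as a
reducible `abbrev` to be passed explicitly (no instance is declared). [folklore] -/
abbrev residueAlgebra (π : X' ⟶ X) (x' : X') : Algebra (X.residueField (π.base x')) (X'.residueField x') :=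
  (π.residueFieldMap x').hom.toAlgebra

/-- [OURS · L1 W4.2] THE MONOTONICITY INEQUALITY at the point `x′` over `x = π x′`:
`dim F_{x′}(X′) + trdeg(κ(x′)/κ(x)) ≤ dim F_x(X)` (ridge dimensions `Scheme.ridgeDim` of `RidgeLocal.lean`, cast to
`Cardinal`; transcendence degree `Algebra.trdeg` for the algebra structure `residueAlgebra π x′`). The ridge analogue of
CJS Thm. 3.10 (4) (`e_{x′} ≤ e_x − trdeg`). NOT a statement of the manuscript; a campaign statement, not a fact.
[folklore] -/
def RidgeDimDropAt [IsLocallyNoetherian X] [IsLocallyNoetherian X'] (π : X' ⟶ X) (x' : X') : Prop :=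
  (Scheme.ridgeDim X' x' : Cardinal.{u}) +
      @Algebra.trdeg (X.residueField (π.base x')) (X'.residueField x') _ _ (residueAlgebra π x') ≤
    (Scheme.ridgeDim X (π.base x') : Cardinal.{u})

/-- [OURS · L1 W4.2] replaces the role of the SECOND HALF («moreover dim F_{x′}(X′) ≤ dim F_x(X) − trdeg(k(x′)/k(x)) at near
points») of the informal crux `RidgeConfinement` (stmt-ResolutionOfSingularities-17845, route HilbertSamuelElimination);
NOT a statement of the manuscript. For every field `k` of characteristic `p`, every reduced separated scheme `X` of finite
type over `k`, every permissible centre `V(D) ⊆ X` (CJS Def. 3.1: regular, `X` normally flat along it, no component —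
tree `IdealSheafData.IsPermissible`), every blow-up `π : X′ → X` of `X` along `D` (tree `IsBlowup`), every `N ≥ dim X`,
and every point `x′` of `X′` lying over `V(D)` that is NEAR to `π x′` at level `N`: `RidgeDimDropAt π x′`. VACUITY: not
vacuous (near points over permissible centres exist, e.g. on the blown-up Hironaka quadric of
`Literature.Barriers.ResolutionOfSingularities.DirectrixSmallCharacteristic`, where the statement must hold first).
[folklore] -/
def RidgeDimMonotone (p : ℕ) : Prop :=
  ∀ (k : Type u) [Field k] [CharP k p] (X : Scheme.{u}) [IsLocallyNoetherian X] (f : X ⟶ Spec (.of k)),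
    IsSeparated f → LocallyOfFiniteType f → QuasiCompact f → IsReduced X →
    ∀ (D : X.IdealSheafData), IdealSheafData.IsPermissible D →
    ∀ (X' : Scheme.{u}) [IsLocallyNoetherian X'] (π : X' ⟶ X), IsBlowup π D →
    ∀ (N : ℕ), topologicalKrullDim X ≤ (N : WithBot ℕ∞) →
    ∀ (x' : X'), π.base x' ∈ D.support → IsNearPoint π N x' → RidgeDimDropAt π x'

/-- [OURS · L1 W4.2] the SANITY RUNG of S-s42 («Rid_red = Dir over perfect residue fields», route-file remark on the O1
escape; Giraud 1975 §1.5): for every field `k` of characteristic `p`, every reduced separated `X` of finite type over `k`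
and every point `x` whose residue field `κ(x)` is PERFECT, the ridge and the directrix have the same dimension,
`dim F_x(X) = e_x(X)` (`Scheme.ridgeDim X x = Scheme.dirDim X x`; `≥` is the tree's `Scheme.dirDim_le_ridgeDim`). NOT a
statement of the manuscript. VACUITY: not implied by the tree's inequality; fails for imperfect `κ(x)` (Hironaka's quadric:
`e_x = 0 < dim F_x`). [folklore] -/
def RidgeDimEqDirDimOfPerfect (p : ℕ) : Prop :=
  ∀ (k : Type u) [Field k] [CharP k p] (X : Scheme.{u}) [IsLocallyNoetherian X] (f : X ⟶ Spec (.of k)),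
    IsSeparated f → LocallyOfFiniteType f → QuasiCompact f → IsReduced X →
    ∀ (x : X), PerfectField (X.residueField x) → Scheme.ridgeDim X x = Scheme.dirDim X x

end CampaignW42

end Summit.ResolutionOfSingularities.ResolutionOfSingularities.Theorems

end
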